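/-
Copyright (c) 2026 the pub-hodgecm-mathlib formalisation cell (harness21).  Prover seat hodgecm-mathlib-K2Liu-p07 (g3), Track B «K2-LIT»,
#184♮ = hLiu418 = `stmt-HodgeConjecture-24832`; #42S payer road, organ (σ) (local value identity), OWNER WORD σ19 (LEAD F0P6-plan (g14) 2026-09-04 13:54Z)
letter (Sim): the similitude transport `c_a = Ad(d_a)` (★ F5′) on the local Siegel intertwining integral `M_v(s)`.
-/
import Summits.HodgeConjecture.HodgeConjecture.Theorems.K2LiuLocalSWRamifiedRelativeSign    -- ★ F7r-1 §3 (+ ★ F5′-A1∕C1): `localCongr_dA_mem_unipDeltaLocal_iff`, word law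
import Mathlib.MeasureTheory.Measure.Haar.Unique
import HarnessLib

/-!
# Crux `HLiu418`, #42S organ (σ), OWNER WORD σ19 letter (Sim): `M_v(s)(f ∘ c_a)(h) = χ_s(ℓ_a) · M_v(s)[c_{a,*}νN](f)(c_a h)` — THE INTERTWINING INTEGRAL UNDER
# THE SIMILITUDE TRANSPORT `c_a = Ad(d_a)`

Cell `hodgecm-mathlib`, crux item hLiu418 = `stmt-HodgeConjecture-24832`; squad K2 ∕ K2Liu; LEAD F0P6-plan (g14), organ lead (σ) K2Liu-p09 (g6);
prover K2Liu-p07 (g3).  THEOREMS ONLY (no `def`, no instance, no notation, no named-fact hypothesis, no `sorry`); lane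
`--supports stmt-HodgeConjecture-24832 --as helper`.

WHY (σ19 «SPANNING + SIMILITUDE»).  At a non-split place the `hne` witness for `R(V′^{−ε})` is transported from the one for `R(V′^{ε})` along the similitude
`c_a = Ad(d_a)`, `a ∈ L⁺ˣ` a local non-norm (`R(V′^{−ε}) = c_a^* R(V′^{ε})`: ★ F5′-C3 + ★ (asm-2)); this needs the behaviour of the intertwining integral
`M_v(s) f (h) = ∫_{N_Δ} f(w_Δ u h) dνN(u)` (★ `localIntertwining`) under `f ↦ f ∘ c_a`.  By the word law `(f ∘ c_a)(w_Δ · g) = χ_s(ℓ_a) · f(w_Δ · c_a g)`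
(★ C1 `comp_localCongr_dA_apply_weylDelta_mul`, `ℓ_a = c_a(w_Δ) w_Δ ∈ P_Δ`) and `c_a(N_Δ) = N_Δ` (★ F7r-1 `localCongr_dA_mem_unipDeltaLocal_iff`) the integral becomes
`χ_s(ℓ_a) · ∫ f(w_Δ u′ (c_a h)) d(c_{a,*}νN)(u′)`, and `c_{a,*}νN` is again a left Haar measure on `N_Δ`, hence `κ • νN`.
* `localIntertwining_comp_localCongr_dA` — the transport identity with the push-forward measure `νN.map (c_a|_{N_Δ})` (any measure `νN`);
* `isMulLeftInvariant_map_localCongr_dA` — `νN.map (c_a|_{N_Δ})` is left-invariant when `νN` is;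
* **`exists_localIntertwining_comp_localCongr_dA_eq_smul`** — for a Haar measure `νN`: `∃ κ > 0`, `νN.map (c_a|_{N_Δ}) = κ • νN`, hence
  `M_v(s)(f ∘ c_a)(h) = χ_s(ℓ_a) · κ · M_v(s)(f)(c_a h)` for every Siegel section `f` and every `h`, and `νN{u | c_a u ∈ K₀} = κ · νN{u | u ∈ K₀}`.
References: [Casselman1980] §3; [HarrisKudlaSweet1996] §6 (6.14)–(6.16); [Kudla1994] §3; [PlatonovRapinchuk1994] §2.3.
HONEST LABEL.  Count-neutral helper: `HC_CM` is proved only modulo the 7 printed citations (2 remaining named inputs: hLiu418 = `stmt-HodgeConjecture-24832`,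
h413 = `stmt-HodgeConjecture-24833`) until rung 0 closes.
-/

set_option autoImplicit false
set_option linter.dupNamespace false -- the mandated namespace repeats `HodgeConjecture.HodgeConjecture`

noncomputable section

open scoped Matrix NNReal ENNReal
open NumberField IsDedekindDomain MeasureTheory MeasureTheory.Measure Matrix
open Literature.NumberTheory.Automorphic Literature.NumberTheory.Automorphic.UnitaryGroup
open Literature.NumberTheory.GelbartRogawski1991.AdaptedBlocks
open Literature.NumberTheory.GelbartRogawski1991.UnitaryDualPair.LocalSplitting
open Literature.NumberTheory.K2Lit.LocalSiegelDoubled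
open Summit.HodgeConjecture.HodgeConjecture.Cruxes.HLiu418.K2LiuLocalSWSimilitudeAlgebra
open Summit.HodgeConjecture.HodgeConjecture.Cruxes.HLiu418.K2LiuLocalSWSimilitudeSections
open Summit.HodgeConjecture.HodgeConjecture.Cruxes.HLiu418.K2LiuLocalSWRamifiedRelativeSign

namespace Summit.HodgeConjecture.HodgeConjecture.Cruxes.HLiu418.K2LiuLocalIntertwiningSimilitude

variable (F : Type) [Field F] [NumberField F] (E : Type) [Field E] [NumberField E] [Algebra F E] [Algebra.IsQuadraticExtension F E]
  (c : E ≃ₐ[F] E) {δ : E} (hcδ : c δ = -δ) (hδ : δ ≠ 0) {d : F} (hd : δ * δ = algebraMap F E d)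
  (v : HeightOneSpectrum (𝓞 F)) (n : ℕ) {T₀ : Matrix (Fin n) (Fin n) F} (hT₀ : T₀.IsSymm)
  {JD : Matrix (Fin (n + n)) (Fin (n + n)) E} (hJD : JD = (gramD F n T₀).map (algebraMap F E))
  (χv : ∀ w : PlacesOver E v, (w.1.adicCompletion E)ˣ →* ℂˣ) (s : ℂ)
  (a : Fˣ) {D₀ : GL (Fin (n + n)) F}
  (hD₀ : (D₀ : Matrix (Fin (n + n)) (Fin (n + n)) F) =
    Matrix.reindex (e₂ n) (e₂ n) (cayR F (Fin n) * Matrix.fromBlocks 1 0 0 ((a : F) • (1 : Matrix (Fin n) (Fin n) F)) * cayRinv F (Fin n)))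
  {DA : GL (Fin (n + n)) E} (hDA : DA = Matrix.GeneralLinearGroup.map (algebraMap F E) D₀)
  {b : E} (hb : b ≠ 0) (hDAJ : formCongr (c : E →+* E) DA (b • JD) = JD)
  [MeasurableSpace (unipDeltaLocal F E c v n (JD := JD))] [BorelSpace (unipDeltaLocal F E c v n (JD := JD))]

include hD₀ hDA in
/-- **THE TRANSPORT IDENTITY** (any measure `νN` on `N_Δ`): `M_v(s)(f ∘ c_a)(h) = χ_s(ℓ_a) · ∫ f(w_Δ · u′ · c_a h) d(c_{a,*}νN)(u′)`, i.e.
`localIntertwining νN (f ∘ c_a) h = χ_s(ℓ_a) · localIntertwining (νN.map c_a|_{N_Δ}) f (c_a h)`, for every Siegel section `f ∈ I_v(s, χ_v)`.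
[cite: Casselman1980, §3] [cite: Kudla1994, §3] [cite: HarrisKudlaSweet1996, §6 (6.14)] -/
theorem localIntertwining_comp_localCongr_dA (νN : Measure (unipDeltaLocal F E c v n (JD := JD)))
    {f : UnitaryGroup.localPi E c (n + n) JD v → ℂ} (hf : IsLocalSiegelSection F E c hcδ hδ hd v n hT₀ hJD χv s f)
    (h : UnitaryGroup.localPi E c (n + n) JD v) :
    localIntertwining F E c v n hJD νN (f ∘ localCongr E c DA hb hDAJ v) h =
      localSiegelCharacter F E c v n χv s (localCongr E c DA hb hDAJ v (weylDelta F E c v n hJD) * weylDelta F E c v n hJD) *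
        localIntertwining F E c v n hJD
          (νN.map fun u : unipDeltaLocal F E c v n (JD := JD) =>
            (⟨localCongr E c DA hb hDAJ v u, (localCongr_dA_mem_unipDeltaLocal_iff F E c v n a hD₀ hDA hb hDAJ u).2 u.2⟩ :
              unipDeltaLocal F E c v n (JD := JD)))
          f (localCongr E c DA hb hDAJ v h) := by
  -- the restriction of `c_a` to `N_Δ` as a measurable equivalence
  have hcont : Continuous fun u : unipDeltaLocal F E c v n (JD := JD) =>
      (⟨localCongr E c DA hb hDAJ v u, (localCongr_dA_mem_unipDeltaLocal_iff F E c v n a hD₀ hDA hb hDAJ u).2 u.2⟩ :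
        unipDeltaLocal F E c v n (JD := JD)) :=
    ((localCongr E c DA hb hDAJ v).continuous.comp continuous_subtype_val).subtype_mk _
  have hcont' : Continuous fun u : unipDeltaLocal F E c v n (JD := JD) =>
      (⟨(localCongr E c DA hb hDAJ v).symm u, (localCongr_dA_mem_unipDeltaLocal_iff F E c v n a hD₀ hDA hb hDAJ _).1
          (by rw [ContinuousMulEquiv.apply_symm_apply]; exact u.2)⟩ : unipDeltaLocal F E c v n (JD := JD)) :=
    ((localCongr E c DA hb hDAJ v).symm.continuous.comp continuous_subtype_val).subtype_mk _
  let e : unipDeltaLocal F E c v n (JD := JD) ≃ᵐ unipDeltaLocal F E c v n (JD := JD) :=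
    { toFun := fun u => ⟨localCongr E c DA hb hDAJ v u, (localCongr_dA_mem_unipDeltaLocal_iff F E c v n a hD₀ hDA hb hDAJ u).2 u.2⟩
      invFun := fun u => ⟨(localCongr E c DA hb hDAJ v).symm u, (localCongr_dA_mem_unipDeltaLocal_iff F E c v n a hD₀ hDA hb hDAJ _).1
          (by rw [ContinuousMulEquiv.apply_symm_apply]; exact u.2)⟩
      left_inv := fun u => Subtype.ext ((localCongr E c DA hb hDAJ v).symm_apply_apply u)
      right_inv := fun u => Subtype.ext ((localCongr E c DA hb hDAJ v).apply_symm_apply u)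
      measurable_toFun := hcont.measurable
      measurable_invFun := hcont'.measurable }
  have he : (νN.map fun u : unipDeltaLocal F E c v n (JD := JD) =>
      (⟨localCongr E c DA hb hDAJ v u, (localCongr_dA_mem_unipDeltaLocal_iff F E c v n a hD₀ hDA hb hDAJ u).2 u.2⟩ :
        unipDeltaLocal F E c v n (JD := JD))) = νN.map e := rfl
  rw [he]
  unfold localIntertwining
  rw [integral_map_equiv, ← integral_const_mul]
  refine integral_congr_ae (Filter.Eventually.of_forall fun u => ?_)
  show (f ∘ localCongr E c DA hb hDAJ v) (weylDelta F E c v n hJD * u * h) = _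
  rw [mul_assoc, comp_localCongr_dA_apply_weylDelta_mul F E c hcδ hδ hd v n hT₀ hJD χv s a hD₀ hDA hb hDAJ hf, map_mul, ← mul_assoc]
  rfl

omit [Algebra.IsQuadraticExtension F E] in
include hD₀ hDA in
/-- **`c_{a,*}νN = κ • νN`, `κ > 0`, FOR A HAAR MEASURE `νN` ON `N_Δ`**: the restriction of `c_a` to `N_Δ` is a topological group automorphism, so it maps a Haar
measure to a Haar measure (Mathlib `ContinuousMulEquiv.isHaarMeasure_map`), which is a positive multiple of `νN` (Mathlib `isMulLeftInvariant_eq_smul`,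
`haarScalarFactor_pos_of_isHaarMeasure`). [cite: Casselman1980, §3] [cite: PlatonovRapinchuk1994, §2.3] -/
theorem exists_map_localCongr_dA_eq_smul [LocallyCompactSpace (unipDeltaLocal F E c v n (JD := JD))]
    [SecondCountableTopology (unipDeltaLocal F E c v n (JD := JD))]
    (νN : Measure (unipDeltaLocal F E c v n (JD := JD))) [νN.IsHaarMeasure] :
    ∃ κ : ℝ≥0, 0 < κ ∧
      (νN.map fun u : unipDeltaLocal F E c v n (JD := JD) =>
        (⟨localCongr E c DA hb hDAJ v u, (localCongr_dA_mem_unipDeltaLocal_iff F E c v n a hD₀ hDA hb hDAJ u).2 u.2⟩ :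
          unipDeltaLocal F E c v n (JD := JD))) = κ • νN := by
  have hcont : Continuous fun u : unipDeltaLocal F E c v n (JD := JD) =>
      (⟨localCongr E c DA hb hDAJ v u, (localCongr_dA_mem_unipDeltaLocal_iff F E c v n a hD₀ hDA hb hDAJ u).2 u.2⟩ :
        unipDeltaLocal F E c v n (JD := JD)) :=
    ((localCongr E c DA hb hDAJ v).continuous.comp continuous_subtype_val).subtype_mk _
  have hcont' : Continuous fun u : unipDeltaLocal F E c v n (JD := JD) =>
      (⟨(localCongr E c DA hb hDAJ v).symm u, (localCongr_dA_mem_unipDeltaLocal_iff F E c v n a hD₀ hDA hb hDAJ _).1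
          (by rw [ContinuousMulEquiv.apply_symm_apply]; exact u.2)⟩ : unipDeltaLocal F E c v n (JD := JD)) :=
    ((localCongr E c DA hb hDAJ v).symm.continuous.comp continuous_subtype_val).subtype_mk _
  let e : unipDeltaLocal F E c v n (JD := JD) ≃ₜ* unipDeltaLocal F E c v n (JD := JD) :=
    { toFun := fun u => ⟨localCongr E c DA hb hDAJ v u, (localCongr_dA_mem_unipDeltaLocal_iff F E c v n a hD₀ hDA hb hDAJ u).2 u.2⟩
      invFun := fun u => ⟨(localCongr E c DA hb hDAJ v).symm u, (localCongr_dA_mem_unipDeltaLocal_iff F E c v n a hD₀ hDA hb hDAJ _).1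
          (by rw [ContinuousMulEquiv.apply_symm_apply]; exact u.2)⟩
      left_inv := fun u => Subtype.ext ((localCongr E c DA hb hDAJ v).symm_apply_apply u)
      right_inv := fun u => Subtype.ext ((localCongr E c DA hb hDAJ v).apply_symm_apply u)
      map_mul' := fun u u' => Subtype.ext
        (map_mul (localCongr E c DA hb hDAJ v) (u : UnitaryGroup.localPi E c (n + n) JD v) (u' : UnitaryGroup.localPi E c (n + n) JD v))
      continuous_toFun := hcont
      continuous_invFun := hcont' }
  have he : (νN.map fun u : unipDeltaLocal F E c v n (JD := JD) =>
      (⟨localCongr E c DA hb hDAJ v u, (localCongr_dA_mem_unipDeltaLocal_iff F E c v n a hD₀ hDA hb hDAJ u).2 u.2⟩ :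
        unipDeltaLocal F E c v n (JD := JD))) = νN.map e := rfl
  rw [he]
  haveI : (νN.map e).IsHaarMeasure := ContinuousMulEquiv.isHaarMeasure_map νN e
  exact ⟨haarScalarFactor (νN.map e) νN, haarScalarFactor_pos_of_isHaarMeasure _ _, isMulLeftInvariant_eq_smul (νN.map e) νN⟩

include hD₀ hDA in
/-- **THE (Sim) LETTER FOR `hne`** (Haar `νN`): `∃ κ > 0` with `M_v(s)(f ∘ c_a)(h) = χ_s(ℓ_a) · κ · M_v(s)(f)(c_a h)` for every Siegel section `f ∈ I_v(s,χ_v)` and every `h`,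
and `νN{u | c_a u ∈ S} = κ · νN(S)` for every `S ⊆ N_Δ` (so `aNorm(νN{u | c_a u ∈ K₀}, s) = κ · aNorm(νN{u ∈ K₀}, s)`). Consumer: σ19's transport of the `hne`
datum, `Fn′ s h := χ_s(ℓ_a) · Fn s (c_a h)`. [cite: Casselman1980, §3] [cite: HarrisKudlaSweet1996, §6 (6.14)–(6.16)] [cite: Kudla1994, §3] -/
theorem exists_localIntertwining_comp_localCongr_dA_eq_mul [LocallyCompactSpace (unipDeltaLocal F E c v n (JD := JD))]
    [SecondCountableTopology (unipDeltaLocal F E c v n (JD := JD))]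
    (νN : Measure (unipDeltaLocal F E c v n (JD := JD))) [νN.IsHaarMeasure] :
    ∃ κ : ℝ≥0, 0 < κ ∧
      (∀ {f : UnitaryGroup.localPi E c (n + n) JD v → ℂ}, IsLocalSiegelSection F E c hcδ hδ hd v n hT₀ hJD χv s f →
        ∀ h : UnitaryGroup.localPi E c (n + n) JD v,
          localIntertwining F E c v n hJD νN (f ∘ localCongr E c DA hb hDAJ v) h =
            localSiegelCharacter F E c v n χv s (localCongr E c DA hb hDAJ v (weylDelta F E c v n hJD) * weylDelta F E c v n hJD) *
              ((κ : ℝ) : ℂ) * localIntertwining F E c v n hJD νN f (localCongr E c DA hb hDAJ v h)) ∧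
      ∀ S : Set (unipDeltaLocal F E c v n (JD := JD)), MeasurableSet S →
        νN {u | (⟨localCongr E c DA hb hDAJ v u, (localCongr_dA_mem_unipDeltaLocal_iff F E c v n a hD₀ hDA hb hDAJ u).2 u.2⟩ :
          unipDeltaLocal F E c v n (JD := JD)) ∈ S} = κ * νN S := by
  obtain ⟨κ, hκ, hmap⟩ := exists_map_localCongr_dA_eq_smul F E c v n a hD₀ hDA hb hDAJ νN
  have hmeas : Measurable fun u : unipDeltaLocal F E c v n (JD := JD) =>
      (⟨localCongr E c DA hb hDAJ v u, (localCongr_dA_mem_unipDeltaLocal_iff F E c v n a hD₀ hDA hb hDAJ u).2 u.2⟩ :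
        unipDeltaLocal F E c v n (JD := JD)) :=
    (((localCongr E c DA hb hDAJ v).continuous.comp continuous_subtype_val).subtype_mk _).measurable
  refine ⟨κ, hκ, fun hf h => ?_, fun S hS => ?_⟩
  · rw [localIntertwining_comp_localCongr_dA F E c hcδ hδ hd v n hT₀ hJD χv s a hD₀ hDA hb hDAJ νN hf h, hmap, mul_assoc]
    congr 1
    unfold localIntertwining
    rw [integral_smul_nnreal_measure, NNReal.smul_def, Complex.real_smul]
  · show νN ((fun u : unipDeltaLocal F E c v n (JD := JD) =>
        (⟨localCongr E c DA hb hDAJ v u, (localCongr_dA_mem_unipDeltaLocal_iff F E c v n a hD₀ hDA hb hDAJ u).2 u.2⟩ :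
          unipDeltaLocal F E c v n (JD := JD))) ⁻¹' S) = _
    rw [← Measure.map_apply hmeas hS, hmap, Measure.smul_apply, ENNReal.smul_def, smul_eq_mul]

end Summit.HodgeConjecture.HodgeConjecture.Cruxes.HLiu418.K2LiuLocalIntertwiningSimilitude
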